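import Literature.AlgebraicGeometry.HodgeTheory.VHSDataLocallyFlatCharted
import Literature.AlgebraicGeometry.HodgeTheory.VHSDataBoundedHodgeClassesFiniteOverCurve
import HarnessLib

/-!
# Cattani–Deligne–Kaplan over a curve: all but finitely many integral Hodge classes of bounded norm are GENERIC — the pairs `(s, u) ∈ S^{(K)}`
# admitting NO determination of type `(p,p)` at some point of `S` (such pairs lie on zero-dimensional components of `S^{(K)}`) lie over FINITELY
# many points of `S`

Topic `Literature/AlgebraicGeometry/HodgeTheory` (namespaces `Literature.AlgebraicGeometry.HodgeTheory` for the two topological lemmas of §1,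
`Literature.AlgebraicGeometry.Motives.VHSData[.InteriorChart ∕ .PunctureChart ∕ .IsLocallyFlatCharted]` for the rest), lane `lit-hodgefound` (seat `p08`,
row g60-#8).  ONE DEFINITION WITH BODY (`VHSData.nonGenericHodgeLocus D p K ⊆ S`, the set of points carrying an integral class of type `(p,p)` and
self-intersection `≤ K` some determination of which FAILS to be of type `(p,p)` somewhere) and THEOREMS; no named fact, no instance, no notation
(D-0026 net debt `0`).  Sequel of `VHSDataLocallyFlatCharted` (Cor. 1.3: every determination locus is everything or finite),
`VHSDataHodgeLocusInteriorChart` (finitely many flat values of bounded Hodge classes over an interior chart; identity principle),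
`VHSDataPunctureChart` ∕ `VHSDataHodgeLocusNearPuncture` (Thm. 2.5 ∕ 1.5 in a puncture chart) and `VHSDataBoundedHodgeClassesFiniteOverCurve`
(finite fibres of `S^{(K)} → S`).

PRINTED SOURCE, VERBATIM (E. Cattani, P. Deligne, A. Kaplan, *On the locus of Hodge classes*, J. AMS 8 (1995); held text `paper:arxiv-alg-geom_9402009`
p0001).  P. 484: «Fix an integer `K` and let `S^{(K)}` be the space of pairs `(s,u)` with `s ∈ S`, `u ∈ 𝒱_s` integral of type `(0,0)`, and `Q(u,u) ≤ K`.
It projects to `S` and arguments as above show that, locally on `S`, `S^{(K)}` is a finite disjoint sum of closed analytic subspaces. Our main result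
is: **Theorem 1.1.** `S^{(K)}` is an algebraic variety, finite over `S`.»; «**Corollary 1.3.** Let `u` be a section of the local system `𝒱_ℤ` on a
universal covering of `S`. The set of points in `S` where some determination of `u` is of type `(0,0)`, is an algebraic subvariety of `S`. *Proof*:
Such set is a union of images of connected components of `S^{(K)}`, for `K = Q(u,u)`.»  Over a connected CURVE `S` this reads: `S^{(K)}` has finitely
many connected components, each finite over `S`; a component is either a point or dominates `S`; for a pair `(s, u)` on a DOMINATING component
the set of points where some determination of `u` is of type `(p,p)` is ALL of `S` (call such a pair GENERIC); hence the NON-GENERIC pairs lie on the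
finitely many zero-dimensional components (the converse fails in general: a pair isolated in `S^{(K)}` may still be generic through the global
monodromy).  THIS FILE PROVES THE SHADOW OF THAT STRUCTURE ON `S`: the points carrying a non-generic class form a finite set (§4), and — the fibres
being finite — so do the non-generic pairs themselves (§5).

THE DICTIONARY.  `D : VHSData S k` over a preconnected `S` with bundled FLAT period charts (`IsLocallyFlatCharted ψ σ`: flat interior charts on
coordinate balls around every point of the discs `ψ a` covering `S`, flat unipotent puncture charts along the ends `σ i`; open ends, compact core,
continuous end maps — exactly the hypotheses of the tree's Cor. 1.3 `IsLocallyFlatCharted.determinationLocus_eq_univ_or_finite`); level `p + p = k`;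
«some determination of `u ∈ V_ℤ,s` is of type `(p,p)` at `t`» is `∃ γ : Path.Homotopic.Quotient s t, D.IsHodgeAt t p (γ · u)`.

CONTENT.
* §1 topology of a base covered by charts into `ℂ`: nonempty open sets are infinite (`HodgeTheory.infinite_of_isOpen_of_mem_source`); punctured
  neighbourhoods pull back along a chart (a private transfer lemma).
* §2 `nonGenericHodgeLocus D p K` and its membership lemmas.
* §3 THE TWO LOCAL FACTS.  **`InteriorChart.IsFlat.eventually_forall_isHodgeAt_subset_determinationLocus`**: on a punctured neighbourhood of any
  point of a flat interior chart, EVERY integral class of type `(p,p)` with `Q(u,u) ≤ K` has determinations of type `(p,p)` throughout the chart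
  domain (the flat values of such classes form a finite set `Φ` — `finite_flatValues_isHodgeAt_interior_chart` —; a value `v ∈ Φ` whose analytic locus
  `{c : h(c)v ∈ F₀^p}` is not the whole disc is met only on a set without accumulation point — identity principle —; a value whose locus is the whole
  disc is of type `(p,p)` at every point of the disc along the flat transport).  **`PunctureChart.IsFlat.exists_forall_isHodgeAt_exists_transport`**:
  beyond some height of a flat puncture chart, every such class at `σ z` has a determination of type `(p,p)` at every `σ z′` beyond the height
  (Thm. 2.5 ∕ 1.5 in the chart: `1 ⊗ e_z(u) ∈ Φ^p(z′)` for all `z′`, read through the flat frame).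
* §4 **`IsLocallyFlatCharted.finite_nonGenericHodgeLocus`** — THE THEOREM: `nonGenericHodgeLocus D p K` is FINITE.  Proof: by §3 and Cor. 1.3
  (a determination locus containing an infinite set is everything; nonempty open subsets of `S` are infinite, §1) the locus has no accumulation point
  and avoids the ends beyond suitable heights; it is closed, lies in the compact core, hence is finite
  (`Set.Finite.of_isClosed_of_subset_isCompact_of_forall_eventually_not_mem`).  `…_of_compactification` (ends read off a compactification),
  `IsFlatCharted.finite_nonGenericHodgeLocus`, and the reading **`IsLocallyFlatCharted.exists_finite_forall_isHodgeAt_forall_exists_transport`**: off a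
  finite set of points, every integral class of type `(p,p)` with `Q(u,u) ≤ K` has, at EVERY point of `S`, a determination of type `(p,p)`.
* §5 **`IsLocallyFlatCharted.finite_setOf_nonGeneric_pairs`**: the non-generic PAIRS `⟨s, u⟩` (`Σ s, V_ℤ,s`) with `Q(u,u) ≤ K` form a finite set
  (§4 and the finiteness of the fibres of `S^{(K)} → S` over interior charts, `InteriorChart.exists_forall_finite_and_ncard_le`) — a finite subset
  of the (finite) set of pairs on the zero-dimensional components of `S^{(K)}`.

HONEST SCOPE.  `dim S = 1`; the flat charts are HYPOTHESES (as in every one-dimensional CDK file of the tree); the analytic-space structure of `S^{(K)}`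
and its connected components are not formalized — only their trace on `S` and on the pairs; no path-connectedness of `S` is assumed (for a base that
is not path connected every class is trivially non-generic and the theorem says the Hodge classes of bounded norm live over finitely many points).

## References

* [CattaniDeligneKaplan1995] E. Cattani, P. Deligne, A. Kaplan, *On the locus of Hodge classes*, J. Amer. Math. Soc. 8 (1995) 483–506: §1, Thm. 1.1,
  Cor. 1.3 (p. 484), Thm. 1.5 and «Proof of 1.5 ⟹ 1.1» (p. 485), Thm. 2.5 (p. 488), 2.12 (p. 491).
* [FritzscheGrauert2002] K. Fritzsche, H. Grauert, *From Holomorphic Functions to Complex Manifolds*, GTM 213 (2002), Ch. I §8 (identity principle,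
  `n = 1`: a nowhere dense analytic set is discrete).
* [VoisinHodgeII2003] C. Voisin, *Hodge Theory and Complex Algebraic Geometry II*, CUP 2003, §5.3.1 Lemma 5.13 (the components of the locus of Hodge
  classes; cite only).
* [Schmid1973] W. Schmid, *Variation of Hodge structure: the singularities of the period mapping*, Invent. Math. 22 (1973), §2, (4.12) (cite only).
-/

noncomputable section

open scoped TensorProduct ComplexOrder
open _root_.Topology _root_.Filter Set

universe u

namespace Literature.AlgebraicGeometry

open Motives Motives.HodgeStructure HodgeTheory Topology
open Motives.HodgeStructure (conj ofRat ofRat_apply conj_ofRat)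

/-! ## §1 Two topological lemmas on a base covered by charts into `ℂ` -/

namespace HodgeTheory

variable {S : Type*} [TopologicalSpace S]

/-- **A nonempty open subset of `S` meeting a chart domain is infinite** (its trace on the chart domain is carried injectively onto a nonempty open
subset of `ℂ`). [cite: FritzscheGrauert2002, Ch. I §8] -/
theorem infinite_of_isOpen_of_mem_source (ψ : OpenPartialHomeomorph S ℂ) {O : Set S} (hO : IsOpen O) {t : S} (ht : t ∈ O) (hts : t ∈ ψ.source) :
    O.Infinite := by
  have h1 : IsOpen (ψ '' (O ∩ ψ.source)) := ψ.isOpen_image_of_subset_source (hO.inter ψ.open_source) inter_subset_right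
  have h2 : (ψ '' (O ∩ ψ.source)).Infinite := infinite_of_mem_nhds (ψ t) (h1.mem_nhds ⟨t, ⟨ht, hts⟩, rfl⟩)
  exact (Set.Infinite.of_image _ h2).mono inter_subset_left

/-- **On a base covered by charts into `ℂ`, nonempty open sets are infinite.** [cite: FritzscheGrauert2002, Ch. I §8] -/
theorem infinite_of_isOpen_of_nonempty {α : Type*} (ψ : α → OpenPartialHomeomorph S ℂ) (hcov : ∀ x : S, ∃ a, x ∈ (ψ a).source) {O : Set S}
    (hO : IsOpen O) (hne : O.Nonempty) : O.Infinite := by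
  obtain ⟨t, ht⟩ := hne
  obtain ⟨a, ha⟩ := hcov t
  exact infinite_of_isOpen_of_mem_source (ψ a) hO ht ha

/-- Pull-back of a punctured-neighbourhood statement along a chart: if `P` holds on a punctured neighbourhood of `ψ x` in `ℂ`, then `P (ψ y)` holds
on a punctured neighbourhood of `x` inside the chart domain (`ψ` is continuous at `x` and injective on its source). [folklore] -/
private theorem eventually_mem_source_and_of_chart (ψ : OpenPartialHomeomorph S ℂ) {x : S} (hx : x ∈ ψ.source) {P : ℂ → Prop}
    (hP : ∀ᶠ c in 𝓝[≠] (ψ x), P c) : ∀ᶠ y in 𝓝[≠] x, y ∈ ψ.source ∧ P (ψ y) := by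
  have h1 : ∀ᶠ y in 𝓝[≠] x, y ∈ ψ.source := mem_nhdsWithin_of_mem_nhds (ψ.open_source.mem_nhds hx)
  have h2 : Tendsto ψ (𝓝[≠] x) (𝓝 (ψ x)) := (ψ.continuousAt hx).tendsto.mono_left nhdsWithin_le_nhds
  have h3 : Tendsto ψ (𝓝[≠] x) (𝓝[≠] (ψ x)) := by
    refine tendsto_nhdsWithin_iff.2 ⟨h2, ?_⟩
    filter_upwards [h1, self_mem_nhdsWithin] with y hy hyx
    exact fun heq => hyx (ψ.injOn hy hx heq)
  filter_upwards [h1, h3.eventually hP] with y hy hPy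
  exact ⟨hy, hPy⟩

end HodgeTheory

namespace Motives.VHSData

variable {S : Type} [TopologicalSpace S] {k : ℤ} (D : VHSData S k)

/-! ## §2 The locus of points carrying a non-generic integral Hodge class of bounded norm -/

/-- **The NON-GENERIC HODGE LOCUS of level `p` and norm bound `K`**: the set of points `s ∈ S` carrying an integral class `u ∈ V_ℤ,s` of type `(p,p)`
with `Q(u,u) ≤ K` such that the set of points where SOME determination of `u` is of type `(p,p)` is NOT all of `S` — contained in the image in `S`
of the zero-dimensional components of `S^{(K)}` (a pair on a component of `S^{(K)}` dominating the curve `S` has determinations of type `(p,p)`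
everywhere). [cite: CattaniDeligneKaplan1995, §1, Thm. 1.1 and Cor. 1.3 with its proof (p. 484)] -/
def nonGenericHodgeLocus (p K : ℤ) : Set S :=
  {s : S | ∃ u : D.VZ.fiber s, D.IsHodgeAt s p u ∧ (D.form s).form (D.toRat s u) (D.toRat s u) ≤ (K : ℚ) ∧
    {t : S | ∃ γ : Path.Homotopic.Quotient s t, D.IsHodgeAt t p (D.VZ.transport γ u)} ≠ univ}

/-- Membership in the non-generic Hodge locus, unfolded. [cite: CattaniDeligneKaplan1995, §1 (p. 484)] -/
theorem mem_nonGenericHodgeLocus_iff (p K : ℤ) (s : S) :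
    s ∈ D.nonGenericHodgeLocus p K ↔ ∃ u : D.VZ.fiber s, D.IsHodgeAt s p u ∧ (D.form s).form (D.toRat s u) (D.toRat s u) ≤ (K : ℚ) ∧
      {t : S | ∃ γ : Path.Homotopic.Quotient s t, D.IsHodgeAt t p (D.VZ.transport γ u)} ≠ univ :=
  Iff.rfl

/-- Off the non-generic locus, every integral class of type `(p,p)` with `Q(u,u) ≤ K` has a determination of type `(p,p)` at EVERY point of `S`.
[cite: CattaniDeligneKaplan1995, §1 and Cor. 1.3 (p. 484)] -/
theorem exists_isHodgeAt_transport_of_not_mem_nonGenericHodgeLocus {p K : ℤ} {s : S} (hs : s ∉ D.nonGenericHodgeLocus p K)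
    {u : D.VZ.fiber s} (hu : D.IsHodgeAt s p u) (hK : (D.form s).form (D.toRat s u) (D.toRat s u) ≤ (K : ℚ)) (t : S) :
    ∃ γ : Path.Homotopic.Quotient s t, D.IsHodgeAt t p (D.VZ.transport γ u) := by
  by_contra hne
  exact hs ⟨u, hu, hK, fun huniv => hne (huniv ▸ mem_univ t : t ∈ {t : S | ∃ γ : Path.Homotopic.Quotient s t,
    D.IsHodgeAt t p (D.VZ.transport γ u)})⟩

/-- A point carrying a class of type `(p,p)` with `Q(u,u) ≤ K` whose determination locus misses some point is in the non-generic locus.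
[cite: CattaniDeligneKaplan1995, §1 (p. 484)] -/
theorem mem_nonGenericHodgeLocus_of_not_exists {p K : ℤ} {s : S} {u : D.VZ.fiber s} (hu : D.IsHodgeAt s p u)
    (hK : (D.form s).form (D.toRat s u) (D.toRat s u) ≤ (K : ℚ)) {t : S}
    (ht : ¬ ∃ γ : Path.Homotopic.Quotient s t, D.IsHodgeAt t p (D.VZ.transport γ u)) : s ∈ D.nonGenericHodgeLocus p K :=
  ⟨u, hu, hK, fun huniv => ht (huniv ▸ mem_univ t : t ∈ {t : S | ∃ γ : Path.Homotopic.Quotient s t, D.IsHodgeAt t p (D.VZ.transport γ u)})⟩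

/-- The non-generic locus grows with the norm bound. [cite: CattaniDeligneKaplan1995, §1 (p. 484)] -/
theorem nonGenericHodgeLocus_mono (p : ℤ) {K K' : ℤ} (hKK' : K ≤ K') : D.nonGenericHodgeLocus p K ⊆ D.nonGenericHodgeLocus p K' :=
  fun _ ⟨u, hu, hK, hne⟩ => ⟨u, hu, hK.trans (by exact_mod_cast hKK'), hne⟩

variable {D}
variable {V : Type u} [AddCommGroup V] [Module ℚ V] [FiniteDimensional ℚ V]

/-! ## §3 The two local facts: interior charts and puncture charts -/

namespace InteriorChart

variable {ψ : OpenPartialHomeomorph S ℂ} {H₀ : HodgeStructure V k} {P₀ : H₀.Polarization} {C : D.InteriorChart ψ P₀}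

omit [FiniteDimensional ℚ V] in
/-- In an interior chart, `u ∈ V_ℤ,ψ⁻¹(c)` is of type `(p,p)` iff `h(c)(1 ⊗ e_c(u)) ∈ F₀^p`. [cite: CattaniDeligneKaplan1995, §1 (p. 483)] -/
theorem isHodgeAt_iff_h_ofRat_mem (C : D.InteriorChart ψ P₀) {c : ℂ} (hc : c ∈ ψ.target) (p : ℤ) (u : D.VZ.fiber (ψ.symm c)) :
    D.IsHodgeAt (ψ.symm c) p u ↔ C.h c (ofRat (C.e c (D.toRat (ψ.symm c) u))) ∈ H₀.F p := by
  rw [D.isHodgeAt_iff_ofRat_mem_of_map_F_eq (C.e c) (C.map_F_eq c hc p) u, Submodule.mem_comap]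

omit [FiniteDimensional ℚ V] in
/-- **FLAT VALUES WHOSE ANALYTIC LOCUS IS THE WHOLE DISC ARE OF TYPE `(p,p)` EVERYWHERE ON THE DISC**: in a FLAT interior chart, if the class `u`
at `ψ⁻¹(c)` has flat value `v = e_c(u)` with `h(c′)(1 ⊗ v) ∈ F₀^p` for EVERY `c′` in the disc, then at every point of the chart domain some
determination of `u` (the flat transport inside the disc) is of type `(p,p)`. [cite: CattaniDeligneKaplan1995, §1 (pp. 483–484)] [cite: Schmid1973, §2] -/
theorem IsFlat.source_subset_determinationLocus_of_forall_mem (hC : C.IsFlat) {p : ℤ} {c : ℂ} (hc : c ∈ ψ.target) (u : D.VZ.fiber (ψ.symm c))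
    (hall : ∀ c' ∈ ψ.target, C.h c' (ofRat (C.e c (D.toRat (ψ.symm c) u))) ∈ H₀.F p) :
    ψ.source ⊆ {t : S | ∃ γ : Path.Homotopic.Quotient (ψ.symm c) t, D.IsHodgeAt t p (D.VZ.transport γ u)} := by
  intro t ht
  have hc' : ψ t ∈ ψ.target := ψ.map_source ht
  obtain ⟨δ, hδ⟩ := hC.exists_transport_eq hc hc'
  rw [show t = ψ.symm (ψ t) from (ψ.left_inv ht).symm]
  refine ⟨δ, ?_⟩
  rw [C.isHodgeAt_iff_h_ofRat_mem hc' p, ← D.transport_toRat, hδ]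
  exact hall (ψ t) hc'

/-- **OFF A SET WITHOUT ACCUMULATION POINT, EVERY BOUNDED HODGE CLASS OVER A FLAT INTERIOR CHART IS OF TYPE `(p,p)` ALL OVER THE DISC** («locally on
`S`, `S^{(K)}` is a finite disjoint sum of closed analytic subspaces»): for a flat interior chart `C` on the disc `ψ`, `p + p = k`, a norm bound `K`
and a point `x` of the chart domain, on a punctured neighbourhood of `x` every integral class `u` of type `(p,p)` with `Q(u,u) ≤ K` has a
determination of type `(p,p)` at EVERY point of the chart domain.  The flat values of such classes over the disc form a FINITE set `Φ`
(`finite_flatValues_isHodgeAt_interior_chart`); the values `v ∈ Φ` whose analytic locus `{c : h(c)(1 ⊗ v) ∈ F₀^p}` is not the whole disc are met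
only away from a punctured neighbourhood of `ψ x` (identity principle, `forall_mem_or_forall_eventually_not_mem_of_analyticOnNhd`); the others are
of type `(p,p)` everywhere by flat transport. [cite: CattaniDeligneKaplan1995, §1 (pp. 483–484), Thm. 1.1] [cite: FritzscheGrauert2002, Ch. I §8] -/
theorem IsFlat.eventually_forall_isHodgeAt_subset_determinationLocus (hC : C.IsFlat) {p : ℤ} (hpk : p + p = k) (K : ℤ) {x : S}
    (hx : x ∈ ψ.source) :
    ∀ᶠ y in 𝓝[≠] x, ∀ u : D.VZ.fiber y, D.IsHodgeAt y p u → (D.form y).form (D.toRat y u) (D.toRat y u) ≤ (K : ℚ) →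
      ψ.source ⊆ {t : S | ∃ γ : Path.Homotopic.Quotient y t, D.IsHodgeAt t p (D.VZ.transport γ u)} := by
  -- the finite set of flat values of bounded Hodge classes over the disc, and its «bad» part
  have hΦ := D.finite_flatValues_isHodgeAt_interior_chart hpk ψ.symm ψ.target C.e H₀ P₀ C.Λ C.fg_Λ C.e_toRat_mem C.κ_pos
    (fun _ hc x => C.mul_hodgeNorm_ofRat_le hc x) K
  set Φ : Set V := {v : V | ∃ c ∈ ψ.target, ∃ u : D.VZ.fiber (ψ.symm c), C.e c (D.toRat (ψ.symm c) u) = v ∧ D.IsHodgeAt (ψ.symm c) p u ∧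
      (D.form (ψ.symm c)).form (D.toRat (ψ.symm c) u) (D.toRat (ψ.symm c) u) ≤ (K : ℚ)} with hΦ_def
  set Φbad : Set V := {v : V | v ∈ Φ ∧ ¬ ∀ c' ∈ ψ.target, C.h c' (ofRat v) ∈ H₀.F p} with hΦbad_def
  have hΦbad : Φbad.Finite := hΦ.subset fun v hv => hv.1
  -- near `ψ x`, no bad value is of type `(p,p)`
  have hev : ∀ᶠ c in 𝓝[≠] (ψ x), ∀ v ∈ Φbad, C.h c (ofRat v) ∉ H₀.F p :=
    hΦbad.eventually_all.2 fun v hv =>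
      (forall_mem_or_forall_eventually_not_mem_of_analyticOnNhd C.isPreconnected_target C.h C.analyticOnNhd_h (H₀.F p) (ofRat v)).resolve_left
        hv.2 (ψ x) (ψ.map_source hx)
  filter_upwards [eventually_mem_source_and_of_chart ψ hx hev] with y ⟨hy, hPy⟩
  -- at such a point `y = ψ⁻¹(c)`, every bounded Hodge class has a «good» flat value
  have key : ∀ u : D.VZ.fiber (ψ.symm (ψ y)), D.IsHodgeAt (ψ.symm (ψ y)) p u →
      (D.form (ψ.symm (ψ y))).form (D.toRat (ψ.symm (ψ y)) u) (D.toRat (ψ.symm (ψ y)) u) ≤ (K : ℚ) →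
      ψ.source ⊆ {t : S | ∃ γ : Path.Homotopic.Quotient (ψ.symm (ψ y)) t, D.IsHodgeAt t p (D.VZ.transport γ u)} := by
    intro u hu hK
    have hc : ψ y ∈ ψ.target := ψ.map_source hy
    have hvΦ : C.e (ψ y) (D.toRat (ψ.symm (ψ y)) u) ∈ Φ := ⟨ψ y, hc, u, rfl, hu, hK⟩
    refine hC.source_subset_determinationLocus_of_forall_mem hc u ?_
    by_contra hnot
    exact hPy _ ⟨hvΦ, hnot⟩ ((C.isHodgeAt_iff_h_ofRat_mem hc p u).1 hu)
  rw [ψ.left_inv hy] at key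
  exact key

end InteriorChart

namespace PunctureChart

variable {σ : ℂ → S} {L : PolarizedLimitMixedHodgeStructure V k} {C : D.PunctureChart σ L}

/-- **BEYOND SOME HEIGHT OF A FLAT PUNCTURE CHART, EVERY BOUNDED HODGE CLASS IS OF TYPE `(p,p)` ALL ALONG THE END** (Thm. 2.5 ∕ 1.5 in the chart: for
`Im z ≥ A₁` and `u ∈ V_ℤ,σ(z)` of type `(p,p)` with `Q(u,u) ≤ K`, `1 ⊗ e_z(u) ∈ Φ^p(z′)` at every `z′` with `Im z′ ≥ A₁`; read through the FLAT frame,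
the determination of `u` at `σ(z′)` along the end is of type `(p,p)`).  `σ` is asked to be continuous on an open half-plane `{Im > A′}`.
[cite: CattaniDeligneKaplan1995, Thm. 1.5 (p. 485), Thm. 2.5 (p. 488), 2.12 (p. 491), (2.4) (p. 488)] [cite: Schmid1973, §2] -/
theorem IsFlat.exists_forall_isHodgeAt_exists_transport (hC : C.IsFlat) {A' : ℝ} (hσ : ContinuousOn σ {w : ℂ | A' < w.im}) {p : ℤ}
    (hpk : p + p = k) (K : ℤ) :
    ∃ A₁ : ℝ, C.A₀ ≤ A₁ ∧ A' ≤ A₁ ∧ ∀ z : ℂ, A₁ ≤ z.im → ∀ u : D.VZ.fiber (σ z), D.IsHodgeAt (σ z) p u →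
      (D.form (σ z)).form (D.toRat (σ z) u) (D.toRat (σ z) u) ≤ (K : ℚ) →
      ∀ z' : ℂ, A₁ ≤ z'.im → ∃ γ : Path.Homotopic.Quotient (σ z) (σ z'), D.IsHodgeAt (σ z') p (D.VZ.transport γ u) := by
  -- raise the chart so that `σ` is continuous on the closed half-plane of the chart
  have hle : C.A₀ ≤ max C.A₀ (A' + 1) := le_max_left _ _
  have hσ' : ContinuousOn σ {w : ℂ | (C.raise _ hle).A₀ ≤ w.im} :=
    hσ.mono fun w (hw : max C.A₀ (A' + 1) ≤ w.im) => lt_of_lt_of_le (lt_add_one A') ((le_max_right _ _).trans hw)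
  obtain ⟨A₁, -, hA₁, hmem, -⟩ := (C.raise _ hle).exists_threshold_isHodgeAt hpk K
  refine ⟨A₁, hle.trans hA₁, ((le_add_of_nonneg_right zero_le_one).trans (le_max_right _ _)).trans hA₁, fun z hz u hu hK z' hz' => ?_⟩
  obtain ⟨-, hall⟩ := hmem z hz u hK hu
  obtain ⟨δ, hδ⟩ := (hC.raise _ hle).exists_transport_eq hσ' (hA₁.trans hz) (hA₁.trans hz')
  refine ⟨δ, ?_⟩
  rw [D.isHodgeAt_iff_ofRat_mem_of_map_F_eq ((C.raise _ hle).e z') ((C.raise _ hle).map_F_eq z' (hA₁.trans hz') p), ← D.transport_toRat, hδ]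
  exact hall z' hz'

end PunctureChart

/-! ## §4 The theorem: the non-generic Hodge locus of a locally flat-charted variation over a curve is finite -/

namespace IsLocallyFlatCharted

variable {α ι : Type*} {ψ : α → OpenPartialHomeomorph S ℂ} {σ : ι → ℂ → S}

/-- **CATTANI–DELIGNE–KAPLAN, THEOREM 1.1 WITH COROLLARY 1.3 OVER A CURVE: ALL BUT FINITELY MANY BOUNDED HODGE CLASSES ARE GENERIC.**  `D : VHSData S k`
locally flat-charted by discs `ψ a` covering the preconnected `S` and ends `σ i` (open ends beyond the heights `A i`, a compact core off the ends,
continuous end maps); `p + p = k`; `K : ℤ`.  Then **the set of points `s ∈ S` carrying an integral class `u` of type `(p,p)` with `Q(u,u) ≤ K` for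
which the set «some determination of `u` is of type `(p,p)`» is NOT all of `S` is FINITE** — such pairs `(s, u)` lie on zero-dimensional components
of `S^{(K)}` («`S^{(K)}` is an algebraic variety, finite over `S`»; Cor. 1.3's set «is a union of images of connected components of `S^{(K)}`»: the
image of a component dominating `S` is all of `S`).
Proof: a determination locus containing an infinite subset of `S` is all of `S` (Cor. 1.3: it is everything or finite); over a flat interior chart,
off a set without accumulation point every bounded Hodge class is of type `(p,p)` on the whole (infinite) chart domain (§3); beyond some height of each
flat puncture chart every bounded Hodge class is of type `(p,p)` along the whole (open, infinite) end (§3); so the locus is closed, without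
accumulation point, inside the compact core: finite. [cite: CattaniDeligneKaplan1995, §1, Thm. 1.1, Cor. 1.3 (p. 484), Thm. 1.5 and «Proof of
1.5 ⟹ 1.1» (p. 485), Thm. 2.5 (p. 488)] [cite: FritzscheGrauert2002, Ch. I §8] [cite: Schmid1973, §2 (cite only)] -/
theorem finite_nonGenericHodgeLocus [PreconnectedSpace S] (h : D.IsLocallyFlatCharted ψ σ) {p : ℤ} (hpk : p + p = k) (K : ℤ)
    (hcov : ∀ x : S, ∃ a, x ∈ (ψ a).source) (A : ι → ℝ) (hopen : ∀ (i : ι) (A' : ℝ), A i ≤ A' → IsOpen (σ i '' {z : ℂ | A' < z.im}))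
    (hcore : ∀ A' : ι → ℝ, (∀ i, A i ≤ A' i) → ∃ K₀ : Set S, IsCompact K₀ ∧ K₀ ∪ ⋃ i, σ i '' {z : ℂ | A' i < z.im} = univ)
    (hcont : ∀ i, ContinuousOn (σ i) {z : ℂ | A i < z.im}) :
    (D.nonGenericHodgeLocus p K).Finite := by
  -- a determination locus containing an infinite set is everything (Cor. 1.3: everything or finite)
  have hgen : ∀ {s : S} (u : D.VZ.fiber s) {T : Set S},
      T ⊆ {t : S | ∃ γ : Path.Homotopic.Quotient s t, D.IsHodgeAt t p (D.VZ.transport γ u)} → T.Infinite →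
      {t : S | ∃ γ : Path.Homotopic.Quotient s t, D.IsHodgeAt t p (D.VZ.transport γ u)} = univ := fun u _ hT hinf =>
    (h.determinationLocus_eq_univ_or_finite hpk u hcov A hopen hcore hcont).resolve_right fun hf => hinf (hf.subset hT)
  -- (A) no accumulation point: around every point, a punctured neighbourhood avoids the locus
  have hA : ∀ x : S, ∀ᶠ y in 𝓝[≠] x, y ∉ D.nonGenericHodgeLocus p K := fun x => by
    obtain ⟨a, hx⟩ := hcov x
    obtain ⟨r, hr, -, W, _, _, _, H₀, P₀, C, hC⟩ := h.interior a x hx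
    have hxB : x ∈ (restrBall (ψ a) x r).source := mem_restrBall_source_self (ψ a) hx hr
    have hinf : (restrBall (ψ a) x r).source.Infinite :=
      infinite_of_isOpen_of_mem_source (restrBall (ψ a) x r) (restrBall (ψ a) x r).open_source hxB hxB
    filter_upwards [hC.eventually_forall_isHodgeAt_subset_determinationLocus hpk K hxB] with y hy
    rintro ⟨u, hu, hK, hne⟩
    exact hne (hgen u (hy u hu hK) hinf)
  -- (B) beyond some height, the ends avoid the locus
  have hB : ∀ i, ∃ A₁ : ℝ, A i ≤ A₁ ∧ ∀ z : ℂ, A₁ ≤ z.im → σ i z ∉ D.nonGenericHodgeLocus p K := fun i => by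
    obtain ⟨W, _, _, _, L, C, hC⟩ := h.puncture i
    obtain ⟨A₁, -, hA₁, hprop⟩ := hC.exists_forall_isHodgeAt_exists_transport (hcont i) hpk K
    refine ⟨A₁, hA₁, fun z hz => ?_⟩
    rintro ⟨u, hu, hK, hne⟩
    refine hne (hgen u (T := σ i '' {z' : ℂ | A₁ < z'.im}) ?_ ?_)
    · rintro _ ⟨z', hz', rfl⟩
      exact hprop z hz u hu hK z' (le_of_lt hz')
    · exact infinite_of_isOpen_of_nonempty ψ hcov (hopen i A₁ hA₁) ⟨σ i ⟨0, A₁ + 1⟩, ⟨0, A₁ + 1⟩, lt_add_one A₁, rfl⟩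
  choose A' hA' hE using hB
  obtain ⟨K₀, hK₀, hcovK⟩ := hcore A' hA'
  -- (C) closed, inside the compact core, without accumulation point: finite
  have hsub : D.nonGenericHodgeLocus p K ⊆ K₀ := fun s hs => by
    have hs' : s ∈ K₀ ∪ ⋃ i, σ i '' {z : ℂ | A' i < z.im} := by rw [hcovK]; exact mem_univ s
    rcases hs' with hs' | hs'
    · exact hs'
    · obtain ⟨i, z, hz, rfl⟩ := mem_iUnion.1 hs'
      exact absurd hs (hE i z (le_of_lt hz))
  exact Set.Finite.of_isClosed_of_subset_isCompact_of_forall_eventually_not_mem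
    (Literature.Topology.isClosed_of_forall_mem_nhds_or_eventually_not_mem fun x => Or.inr (hA x)) hK₀ hsub fun x _ => hA x

variable {X : Type*} [TopologicalSpace X] [CompactSpace X]

/-- **The same over a PUNCTURED COMPACT CURVE**: the ends, the compact core and the continuity of the end maps read off a compactification
`j : S ↪ X` (`X` compact, `X ∖ j(S) ⊆ {pt i}`, disc charts `φ i` centred at the punctures, `j (σ i z) = (φ i)⁻¹(e^{2πiz})` beyond height `A i`).
[cite: CattaniDeligneKaplan1995, Thm. 1.1, Cor. 1.3 (p. 484), «Proof of 1.5 ⟹ 1.1» (p. 485), 2.3 (p. 487)] -/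
theorem finite_nonGenericHodgeLocus_of_compactification [PreconnectedSpace S] (h : D.IsLocallyFlatCharted ψ σ) {p : ℤ} (hpk : p + p = k)
    (K : ℤ) (hcov : ∀ x : S, ∃ a, x ∈ (ψ a).source) (A : ι → ℝ)
    {j : S → X} (hj : IsEmbedding j) (pt : ι → X) (hpS : ∀ i, pt i ∉ range j) (hcovX : ∀ x : X, x ∉ range j → ∃ i, x = pt i)
    (φ : ι → OpenPartialHomeomorph X ℂ) (hp : ∀ i, pt i ∈ (φ i).source) (hφp : ∀ i, φ i (pt i) = 0)
    (hball : ∀ i, Metric.ball (0 : ℂ) (Real.exp (-(2 * Real.pi * A i))) ⊆ (φ i).target)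
    (hσ : ∀ (i : ι) (z : ℂ), A i < z.im → j (σ i z) = (φ i).symm (Complex.exp (2 * Real.pi * Complex.I * z))) :
    (D.nonGenericHodgeLocus p K).Finite :=
  h.finite_nonGenericHodgeLocus hpk K hcov A (Topology.isOpen_image_ends hj φ A hball σ hσ)
    (Topology.exists_isCompact_core hj pt hpS hcovX φ hp hφp A hball σ hσ) (continuousOn_end_lifts hj φ A hball σ hσ)

/-- **THE READING «ALL BUT FINITELY MANY BOUNDED HODGE CLASSES ARE GENERIC»**: there is a FINITE set `E ⊆ S` such that at every point `s ∉ E`, every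
integral class `u ∈ V_ℤ,s` of type `(p,p)` with `Q(u,u) ≤ K` has, at EVERY point `t` of `S`, a determination of type `(p,p)`.
[cite: CattaniDeligneKaplan1995, §1, Thm. 1.1 and Cor. 1.3 (p. 484)] -/
theorem exists_finite_forall_isHodgeAt_forall_exists_transport [PreconnectedSpace S] (h : D.IsLocallyFlatCharted ψ σ) {p : ℤ}
    (hpk : p + p = k) (K : ℤ) (hcov : ∀ x : S, ∃ a, x ∈ (ψ a).source) (A : ι → ℝ)
    (hopen : ∀ (i : ι) (A' : ℝ), A i ≤ A' → IsOpen (σ i '' {z : ℂ | A' < z.im}))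
    (hcore : ∀ A' : ι → ℝ, (∀ i, A i ≤ A' i) → ∃ K₀ : Set S, IsCompact K₀ ∧ K₀ ∪ ⋃ i, σ i '' {z : ℂ | A' i < z.im} = univ)
    (hcont : ∀ i, ContinuousOn (σ i) {z : ℂ | A i < z.im}) :
    ∃ E : Set S, E.Finite ∧ ∀ s ∉ E, ∀ u : D.VZ.fiber s, D.IsHodgeAt s p u → (D.form s).form (D.toRat s u) (D.toRat s u) ≤ (K : ℚ) →
      ∀ t : S, ∃ γ : Path.Homotopic.Quotient s t, D.IsHodgeAt t p (D.VZ.transport γ u) :=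
  ⟨D.nonGenericHodgeLocus p K, h.finite_nonGenericHodgeLocus hpk K hcov A hopen hcore hcont,
    fun _ hs _ hu hK t => D.exists_isHodgeAt_transport_of_not_mem_nonGenericHodgeLocus hs hu hK t⟩

end IsLocallyFlatCharted

/-- **For a FLAT-CHARTED variation** (global flat charts on the discs; `IsFlatCharted.isLocallyFlatCharted`).
[cite: CattaniDeligneKaplan1995, §1, Thm. 1.1, Cor. 1.3 (p. 484)] -/
theorem IsFlatCharted.finite_nonGenericHodgeLocus [PreconnectedSpace S] {α ι : Type*} {ψ : α → OpenPartialHomeomorph S ℂ} {σ : ι → ℂ → S}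
    (h : D.IsFlatCharted ψ σ) {p : ℤ} (hpk : p + p = k) (K : ℤ) (hcov : ∀ x : S, ∃ a, x ∈ (ψ a).source) (A : ι → ℝ)
    (hopen : ∀ (i : ι) (A' : ℝ), A i ≤ A' → IsOpen (σ i '' {z : ℂ | A' < z.im}))
    (hcore : ∀ A' : ι → ℝ, (∀ i, A i ≤ A' i) → ∃ K₀ : Set S, IsCompact K₀ ∧ K₀ ∪ ⋃ i, σ i '' {z : ℂ | A' i < z.im} = univ)
    (hcont : ∀ i, ContinuousOn (σ i) {z : ℂ | A i < z.im}) :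
    (D.nonGenericHodgeLocus p K).Finite :=
  h.isLocallyFlatCharted.finite_nonGenericHodgeLocus hpk K hcov A hopen hcore hcont

/-! ## §5 The non-generic PAIRS `(s, u)` of bounded norm are finitely many -/

namespace IsLocallyFlatCharted

variable {α ι : Type*} {ψ : α → OpenPartialHomeomorph S ℂ} {σ : ι → ℂ → S}

/-- **THE NON-GENERIC PAIRS OF `S^{(K)}` ARE FINITELY MANY** (pairs on zero-dimensional components of `S^{(K)}`): the pairs `⟨s, u⟩` (`u ∈ V_ℤ,s` of
type `(p,p)`, `Q(u,u) ≤ K`) whose determination locus is not all of `S` form a FINITE subset of `Σ s, V_ℤ,s` — they lie over the finite non-generic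
locus (§4), and over every point the classes of type `(p,p)` with `Q(u,u) ≤ K` are finitely many («`S^{(K)}` … finite over `S`»:
`InteriorChart.exists_forall_finite_and_ncard_le`).
[cite: CattaniDeligneKaplan1995, §1, Thm. 1.1, Cor. 1.3 (p. 484), Thm. 1.5 (p. 485)] [cite: FritzscheGrauert2002, Ch. I §8] -/
theorem finite_setOf_nonGeneric_pairs [PreconnectedSpace S] (h : D.IsLocallyFlatCharted ψ σ) {p : ℤ} (hpk : p + p = k) (K : ℤ)
    (hcov : ∀ x : S, ∃ a, x ∈ (ψ a).source) (A : ι → ℝ) (hopen : ∀ (i : ι) (A' : ℝ), A i ≤ A' → IsOpen (σ i '' {z : ℂ | A' < z.im}))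
    (hcore : ∀ A' : ι → ℝ, (∀ i, A i ≤ A' i) → ∃ K₀ : Set S, IsCompact K₀ ∧ K₀ ∪ ⋃ i, σ i '' {z : ℂ | A' i < z.im} = univ)
    (hcont : ∀ i, ContinuousOn (σ i) {z : ℂ | A i < z.im}) :
    {x : Σ s : S, D.VZ.fiber s | D.IsHodgeAt x.1 p x.2 ∧ (D.form x.1).form (D.toRat x.1 x.2) (D.toRat x.1 x.2) ≤ (K : ℚ) ∧
      {t : S | ∃ γ : Path.Homotopic.Quotient x.1 t, D.IsHodgeAt t p (D.VZ.transport γ x.2)} ≠ univ}.Finite := by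
  -- over every point, finitely many classes of type `(p,p)` with `Q(u,u) ≤ K`
  have hfib : ∀ s : S, {u : D.VZ.fiber s | D.IsHodgeAt s p u ∧ (D.form s).form (D.toRat s u) (D.toRat s u) ≤ (K : ℚ)}.Finite := fun s => by
    obtain ⟨a, hs⟩ := hcov s
    obtain ⟨r, hr, -, W, _, _, _, H₀, P₀, C, -⟩ := h.interior a s hs
    obtain ⟨N, hN⟩ := C.exists_forall_finite_and_ncard_le hpk K
    exact (hN s (mem_restrBall_source_self (ψ a) hs hr)).1
  refine ((h.finite_nonGenericHodgeLocus hpk K hcov A hopen hcore hcont).biUnion fun s _ => (hfib s).image (Sigma.mk s)).subset ?_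
  rintro ⟨s, u⟩ ⟨hu, hK, hne⟩
  exact mem_biUnion (show s ∈ D.nonGenericHodgeLocus p K from ⟨u, hu, hK, hne⟩) ⟨u, ⟨hu, hK⟩, rfl⟩

end IsLocallyFlatCharted

end Motives.VHSData

end Literature.AlgebraicGeometry

end
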